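import Mathlib
import HarnessLib
import Summits.CriticalPhenomena.CardyFormulaZ2.Theorems.CardyMagicRigidityMagicFormulaTOddDensityEven
import Literature.Probability.RandomPlanarGeometry.NestingTransform

/-!
# Odd Taylor coefficients of the nesting transform vanish on the odd sector (crux `MagicFormulaT`)

Crux `Summit.CriticalPhenomena.CardyFormulaZ2.Theses.CardyMagicRigidity.MagicFormulaT`
(stmt-CriticalPhenomena-4836), line `Sketch`, sub-goal `oddOrders_oddSector`.

The complex-coupling transform at mesh `δ` of a density `f : ℂ → ℝ` is
`Φ_δ(t) = E_{1/2}[∏_u 2cos(t θ_u(f) + π/3)]`, `u` over the honeycomb interface loops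
`(siteLoopConfig δ ω).loops` of critical site percolation on `δ𝕋`, `θ_u(f) = ∫_{W(u,·) ≠ 0} f`
(`UnbasedLoop.nestingPhase`). **Theorem (`oddOrders_oddSector`).** If `f` is odd under the point
reflection `z ↦ −z`, then for every mesh `δ > 0` and every odd `k`, `Φ_δ^{(k)}(0) = 0`.

Proof. By `cNesting_even_of_oddDensity` the function `Φ_δ` is even, `Φ_δ(−t) = Φ_δ(t)` for all
`t : ℂ` (as functions, `Φ_δ ∘ neg = Φ_δ`). Pure calculus, no smoothness needed: Mathlib's
`iteratedDeriv_comp_neg` gives `(Φ_δ ∘ neg)^{(k)}(0) = (−1)^k • Φ_δ^{(k)}(−0)`, so for odd `k`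
`Φ_δ^{(k)}(0) = −Φ_δ^{(k)}(0)`, whence `Φ_δ^{(k)}(0) = 0` in characteristic zero.

No definition is introduced; no named fact is used.
-/

noncomputable section

namespace Summit.CriticalPhenomena.CardyFormulaZ2.Cruxes.MagicFormulaT.LineSketch

open MeasureTheory Filter Set
open scoped Real Topology BigOperators ENNReal
open Literature.Probability.RandomPlanarGeometry Literature.Probability.Percolation
  Literature.Probability.LatticeModels

/-- **Sub-goal `oddOrders_oddSector` of line `Sketch` (crux `MagicFormulaT`).** For a density
`f : ℂ → ℝ` odd under `z ↦ −z`, every odd-order derivative at `t = 0` of the complex-coupling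
nesting transform `Φ_δ(t) = E_{1/2}[∏_u 2cos(t θ_u(f) + π/3)]` of critical site percolation on
`δ𝕋` vanishes, at EVERY mesh `δ > 0`: `Φ_δ` is even (`cNesting_even_of_oddDensity`), and the
odd derivatives of an even function vanish at the origin (`iteratedDeriv_comp_neg`). -/
theorem oddOrders_oddSector : ∀ (f : ℂ → ℝ), (∀ z, f (-z) = -f z) → ∀ δ : ℝ, 0 < δ →
    ∀ k : ℕ, Odd k →
    iteratedDeriv k (fun t : ℂ ↦ ∫ ω, (∏ᶠ u ∈ (siteLoopConfig δ ω).loops,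
      2 * Complex.cos (t * ((u.nestingPhase f : ℝ) : ℂ) + (Real.pi : ℂ) / 3))
        ∂(triSitePercolation half)) 0 = 0 := by
  intro f hf δ hδ k hk
  set G : ℂ → ℂ := fun t : ℂ ↦ ∫ ω, (∏ᶠ u ∈ (siteLoopConfig δ ω).loops,
    2 * Complex.cos (t * ((u.nestingPhase f : ℝ) : ℂ) + (Real.pi : ℂ) / 3))
      ∂(triSitePercolation half) with hG
  have heven : (fun t ↦ G (-t)) = G :=
    funext fun t ↦ by simpa only [hG] using cNesting_even_of_oddDensity f hf δ hδ t
  have h1 := iteratedDeriv_comp_neg k G 0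
  rw [heven, neg_zero, hk.neg_one_pow, neg_one_smul] at h1
  exact CharZero.eq_neg_self_iff.1 h1

end Summit.CriticalPhenomena.CardyFormulaZ2.Cruxes.MagicFormulaT.LineSketch

end
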